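import Mathlib
import HarnessLib
import Summits.HubbardSuperconductivity.HubbardSuperconductivity.Theorems.KLProgrammePolarRayCoareaOddLevel

/-!
# Route `KLProgramme` — K3 ENGINE (stmt-HubbardSuperconductivity-20437 `KLRegimeEngineV17F2`), row (c) binder #8 `RS` row / cure (C′), GEO input:
# ODDNESS CANCELLATION ON THE FRAME'S CURVE, part 2 — the USABLE ray-point forms and the CONSUMER-READY open-square form
# (cell gate-hubbard-kl, seat gate-hubbard-kl-p1b g21; continues `…PolarRayCoareaOddLevel` ✓ p756547)

WHY A PART 2.  Part 1's §2/§3 carry the literal `hfac` of `klrf_integral_eq_frame_level_coords_radial`: the profile identity along WHOLE rays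
(`∀ t > 0`).  Every frame band is doubly `2π`-periodic, so a ray from `Γ` re-enters translated copies of the tube OUTSIDE the square, where a
square-supported `h` vanishes while the level is again small — that hypothesis therefore pins the profile to `0` near the Fermi level, and §2/§3
(true as stated) serve only profiles vanishing there, NOT the intended odd profiles.  The coarea `klry_integral_eq_polar_ray_level` uses the identity
only at the ray points `t = u_E(μ+e,θ)`, `e ∈ [−ē, ē]`, all inside the open square; this file states and proves the bound under exactly that:

* §5 `klro_integral_oddLevel_norm_le_on` — under the `section Frame` hypotheses of `…PolarRayCoareaFrame` + the radial `κ₂`: `h` continuous, compactly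
  supported, supported in the open square and the tube `|ε₀ + δ − μ| < ē`, with `h(u_E(μ+e,θ)·(cos θ, sin θ)) = H θ e` for `θ ∈ (−π,π)`, `e ∈ [−ē, ē]`,
  `H θ` ODD, `‖H θ e‖ ≤ C` ⇒ **`‖∫ h‖ ≤ 2π · (2 · (1/d² + π√2·(2+κ₂)/d³) · C · ē²)`**, `d = Dt_min − κ₁` (non-radial coarea
  `klrf_integral_eq_frame_level_coords`, the identity inside `∫_{−ē}^{ē}`, part 1 §1 per angle with `klrj_jacobian_lipschitz`);
  `klro_rayPt_mem_openSq` — the ray points of admissible levels lie in the open square;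
* §6 `klro_integral_oddLevel_norm_le_on_of_frameOK` — the frame instance (`κ₀ = κ₁ = κ₂ := 4A` from `FrameOK`, as part 1 §3);
* §7 `klro_level_gt_of_mem_boundary` — on the boundary of the square `ε₀ ≥ 0`, so the level exceeds `ē` whenever `μ + ē + κ₀ < b`;
  **`klro_integral_openSq_oddLevel_norm_le(_of_frameOK)`** — CONSUMER-READY: for `F : ℝ → E` continuous, ODD, supported in `(−ē, ē)`, `‖F‖ ≤ C` on
  `[−ē, ē]`: `‖∫_{(−π,π)²} F(ε₀(p) + δ(p) − μ) dp‖ ≤ 2π · (2 · L_𝒥 · C · ē²)` (integrand `if |p₁| < π ∧ |p₂| < π then F(…) else 0`, continuous by §7's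
  boundary lemma + `Continuous.if`) — the shape in which the born row's localised tree × `z_S(iω − e_K)` piece arrives after O1 (`klod_*`), the smooth
  twin of the count route O2/O3 (`klol_*`, `…LatticeShellAsymmetry`, `…FrameShellAsymmetry`); lattice passage by part 1 §4 / `klfl_matsubara_latticeAverage_norm_le`.

Pure analysis on the tree's objects (p4's perturbed Fermi radius, k3c2-p2's coarea/Jacobian files); no definitions; nothing about the effective action,
any registered row of 20437, K3, U₀, the window or superconductivity is asserted.
References: BGM 2006 §2.5 (2.56b)–(2.56e) [cite: BenfattoGiulianiMastropietro2006]; HOME/hubbard-kl-k3c2-p2/g30/CURE-C-PRIME-DESIGN.md §2 row 1.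
-/

noncomputable section

namespace Summit.HubbardSuperconductivity.HubbardSuperconductivity.Theorems.KLRegimeSplit

set_option linter.dupNamespace false -- summit = problem name (single-conjunct summit), D-0017

open Real Set MeasureTheory intervalIntegral Literature.MathematicalPhysics.QuantumLattice
open Literature.MathematicalPhysics.QuantumLattice.BandSectorCounting
open Summit.HubbardSuperconductivity.HubbardSuperconductivity.Theorems.PerturbedFermiCurve
open Summit.HubbardSuperconductivity.HubbardSuperconductivity.Theorems.DispersionFlow

/-! ## §5 The ray-point form: the profile identity only AT THE RAY POINTS OF THE ADMISSIBLE LEVELS -/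

section FrameOn

variable {a b : ℝ} (B : BandBounds a b) {δ : (Fin 2 → ℝ) → ℝ} (hδ1 : ContDiff ℝ 1 δ) {κ₀ κ₁ : ℝ}
  (hδ : ∀ k : Fin 2 → ℝ, (∀ i, |k i| ≤ π) → |δ k| ≤ κ₀)
  (hκ : ∀ k : Fin 2 → ℝ, (∀ i, |k i| ≤ π) → ‖fderiv ℝ δ k‖ ≤ κ₁) (hκ₁ : κ₁ < B.Dtmin)

include B hδ1 hδ hκ hκ₁ in
/-- **ODDNESS CANCELLATION ON THE FRAME'S CURVE — ray-point form.**  As `klro_integral_oddLevel_norm_le`, but the profile identity is required ONLY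
at the ray points of the admissible levels: `h(u_E(μ+e,θ)·(cos θ, sin θ)) = H θ e` for `θ ∈ (−π,π)`, `e ∈ [−ē, ē]` (`u_E = perturbedFermiRadius δ`).
With `H θ (−e) = −H θ e` and `‖H θ e‖ ≤ C` on `[−ē, ē]`:
`‖∫ h‖ ≤ 2π · (2 · (1/d² + π√2·(2+κ₂)/d³) · C · ē²)`, `d = Dt_min − κ₁`. -/
theorem klro_integral_oddLevel_norm_le_on {E' : Type*} [NormedAddCommGroup E'] [NormedSpace ℝ E'] {κ₂ : ℝ} (hκ₂ : 0 ≤ κ₂)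
    (hD2 : ∀ θ s t : ℝ, s ∈ Icc 0 (π / ‖dir θ‖) → t ∈ Icc 0 (π / ‖dir θ‖) →
      |fderiv ℝ δ (s • dir θ) (dir θ) - fderiv ℝ δ (t • dir θ) (dir θ)| ≤ κ₂ * |s - t|)
    {h : ℝ × ℝ → E'} (hc : Continuous h) (hcs : HasCompactSupport h) {μ ē : ℝ} (hē : 0 ≤ ē)
    (hlo : a < μ - ē - κ₀) (hhi : μ + ē + κ₀ < b)
    (hsupp : ∀ p : ℝ × ℝ, h p ≠ 0 → |p.1| < π ∧ |p.2| < π ∧ |sqDispersion ![p.1, p.2] + δ ![p.1, p.2] - μ| < ē)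
    {H : ℝ → ℝ → E'}
    (hfac : ∀ θ ∈ Ioo (-π) π, ∀ e ∈ Icc (-ē) ē,
      h (perturbedFermiRadius δ (μ + e) θ * Real.cos θ, perturbedFermiRadius δ (μ + e) θ * Real.sin θ) = H θ e)
    (hodd : ∀ θ e, H θ (-e) = -H θ e) {C : ℝ} (hC : ∀ θ ∈ Ioo (-π) π, ∀ e ∈ Icc (-ē) ē, ‖H θ e‖ ≤ C) :
    ‖∫ p, h p‖ ≤ 2 * π * (2 * (1 / (B.Dtmin - κ₁) ^ 2 + π * Real.sqrt 2 * (2 + κ₂) / (B.Dtmin - κ₁) ^ 3) * C * ē ^ 2) := by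
  have hd : 0 < B.Dtmin - κ₁ := by linarith
  have hL : 0 ≤ 1 / (B.Dtmin - κ₁) ^ 2 + π * Real.sqrt 2 * (2 + κ₂) / (B.Dtmin - κ₁) ^ 3 := by positivity
  rw [klrf_integral_eq_frame_level_coords B hδ1 hδ hκ hκ₁ hc hcs hē hlo hhi hsupp]
  -- per-angle bound by §1, after writing the integrand with the profile on `[−ē, ē]`
  have hθ : ∀ θ ∈ Ioo (-π) π, ‖∫ e in (-ē)..ē,
      (perturbedFermiRadius δ (μ + e) θ *
          (rayDispersionDt θ (perturbedFermiRadius δ (μ + e) θ) +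
            fderiv ℝ δ (perturbedFermiRadius δ (μ + e) θ • dir θ) (dir θ))⁻¹) •
        h (perturbedFermiRadius δ (μ + e) θ * Real.cos θ, perturbedFermiRadius δ (μ + e) θ * Real.sin θ)‖ ≤
      2 * (1 / (B.Dtmin - κ₁) ^ 2 + π * Real.sqrt 2 * (2 + κ₂) / (B.Dtmin - κ₁) ^ 3) * C * ē ^ 2 := by
    intro θ hθ
    -- the continuous level integrand is interval-integrable
    have hu_on : ContinuousOn (fun e : ℝ => perturbedFermiRadius δ (μ + e) θ) (Icc (-ē) ē) := by
      intro e he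
      have hA : ContinuousAt (fun ν : ℝ => perturbedFermiRadius δ ν θ) (μ + e) :=
        klrf_continuousAt_level B hδ1 hδ hκ hκ₁ (by linarith [he.1]) (by linarith [he.2]) θ
      have hB : Continuous (fun e : ℝ => μ + e) := by fun_prop
      exact (ContinuousAt.comp (f := fun e : ℝ => μ + e) (x := e) hA hB.continuousAt).continuousWithinAt
    have hinv := klrf_continuousOn_invPertDt B hδ1 hδ hκ hκ₁ hlo hhi θ
    have hpt : ContinuousOn (fun e : ℝ => ((perturbedFermiRadius δ (μ + e) θ * Real.cos θ,
        perturbedFermiRadius δ (μ + e) θ * Real.sin θ) : ℝ × ℝ)) (Icc (-ē) ē) :=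
      (hu_on.mul continuousOn_const).prodMk (hu_on.mul continuousOn_const)
    have hcont : ContinuousOn (fun e : ℝ => (perturbedFermiRadius δ (μ + e) θ *
          (rayDispersionDt θ (perturbedFermiRadius δ (μ + e) θ) +
            fderiv ℝ δ (perturbedFermiRadius δ (μ + e) θ • dir θ) (dir θ))⁻¹) •
        h (perturbedFermiRadius δ (μ + e) θ * Real.cos θ, perturbedFermiRadius δ (μ + e) θ * Real.sin θ)) (Icc (-ē) ē) :=
      (hu_on.mul hinv).smul (hc.comp_continuousOn hpt)
    have hii := hcont.intervalIntegrable_of_Icc (μ := volume) (by linarith : -ē ≤ ē)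
    -- write the integrand with the profile on `[−ē, ē]`
    have heq : (∫ e in (-ē)..ē,
        (perturbedFermiRadius δ (μ + e) θ *
            (rayDispersionDt θ (perturbedFermiRadius δ (μ + e) θ) +
              fderiv ℝ δ (perturbedFermiRadius δ (μ + e) θ • dir θ) (dir θ))⁻¹) •
          h (perturbedFermiRadius δ (μ + e) θ * Real.cos θ, perturbedFermiRadius δ (μ + e) θ * Real.sin θ)) =
        ∫ e in (-ē)..ē,
          (perturbedFermiRadius δ (μ + e) θ *
              (rayDispersionDt θ (perturbedFermiRadius δ (μ + e) θ) +
                fderiv ℝ δ (perturbedFermiRadius δ (μ + e) θ • dir θ) (dir θ))⁻¹) • H θ e := by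
      refine intervalIntegral.integral_congr fun e he => ?_
      rw [Set.uIcc_of_le (by linarith)] at he
      simp only [hfac θ hθ e he]
    rw [heq]
    refine klro_intervalIntegral_odd_smul_norm_le hē hL ?_ (hodd θ) (hC θ hθ) ?_
    · intro e he e' he'
      have hlip := klrj_jacobian_lipschitz B hδ1 hδ hκ hκ₁ hκ₂ (hD2 θ) (ν := μ + e) (ν' := μ + e')
        (by linarith [he.1]) (by linarith [he.2]) (by linarith [he'.1]) (by linarith [he'.2])
      rwa [add_sub_add_left_eq_sub] at hlip
    · refine (intervalIntegrable_congr fun e he => ?_).mp hii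
      rw [Set.uIoc_of_le (by linarith)] at he
      have he' : e ∈ Icc (-ē) ē := ⟨he.1.le, he.2⟩
      simp only [hfac θ hθ e he']
  have hvol : volume (Ioo (-π) π) < ⊤ := by simp [Real.volume_Ioo]
  have hout := norm_setIntegral_le_of_norm_le_const hvol hθ
  rw [Real.volume_real_Ioo_of_le (by linarith [Real.pi_pos])] at hout
  calc _ ≤ 2 * (1 / (B.Dtmin - κ₁) ^ 2 + π * Real.sqrt 2 * (2 + κ₂) / (B.Dtmin - κ₁) ^ 3) * C * ē ^ 2 * (π - -π) := hout
    _ = 2 * π * (2 * (1 / (B.Dtmin - κ₁) ^ 2 + π * Real.sqrt 2 * (2 + κ₂) / (B.Dtmin - κ₁) ^ 3) * C * ē ^ 2) := by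
        ring

include B hδ in
/-- The ray points of the admissible levels lie in the OPEN square: `|u_E(ν,θ) cos θ| < π`, `|u_E(ν,θ) sin θ| < π` (`a ≤ ν − κ₀`, `ν + κ₀ ≤ b`). -/
theorem klro_rayPt_mem_openSq (hδc : Continuous δ) {ν : ℝ} (hν : a ≤ ν - κ₀) (hν' : ν + κ₀ ≤ b) (θ : ℝ) :
    |perturbedFermiRadius δ ν θ * Real.cos θ| < π ∧ |perturbedFermiRadius δ ν θ * Real.sin θ| < π := by
  have h0 := abs_perturbedFermiRadius_smul_dir_lt B hδc hδ hν hν' θ 0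
  have h1 := abs_perturbedFermiRadius_smul_dir_lt B hδc hδ hν hν' θ 1
  simp only [Pi.smul_apply, smul_eq_mul, dir] at h0 h1
  exact ⟨by simpa using h0, by simpa using h1⟩

end FrameOn

/-! ## §6 The frame instance of the ray-point form under `FrameOK` -/

section FrameOKOn

variable {R : RenConsts} {U c β μ : ℝ} {K : TrigPolyC4v} {a b : ℝ} (B : BandBounds a b)

/-- **Ray-point form on an admissible frame's curve** (`klro_integral_oddLevel_norm_le_on` with the p4 inputs discharged from `FrameOK`, as in §3):
`‖∫ h‖ ≤ 2π · (2 · (1/d² + π√2·(2 + 4A)/d³) · C · ē²)`, `d = B.Dtmin − 4A`, `A = 2·Gfr 0·|U| + 2·Gfr 1·U² + Gfr 2·c/log 4`. -/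
theorem klro_integral_oddLevel_norm_le_on_of_frameOK {E' : Type*} [NormedAddCommGroup E'] [NormedSpace ℝ E']
    (hR : ∀ j, 0 ≤ R.Gfr j) (hc : 0 ≤ c) (hβmin : klBetaMin ≤ β) (hβc : β ≤ Real.exp (c / U ^ 2))
    (hK : FrameOK R U (nScales β) μ K)
    (hA : 4 * (2 * R.Gfr 0 * |U| + 2 * R.Gfr 1 * U ^ 2 + R.Gfr 2 * (c / Real.log 4)) < B.Dtmin)
    {h : ℝ × ℝ → E'} (hcont : Continuous h) (hcs : HasCompactSupport h) {ē : ℝ} (hē : 0 ≤ ē)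
    (hlo : a < μ - ē - 4 * (2 * R.Gfr 0 * |U| + 2 * R.Gfr 1 * U ^ 2 + R.Gfr 2 * (c / Real.log 4)))
    (hhi : μ + ē + 4 * (2 * R.Gfr 0 * |U| + 2 * R.Gfr 1 * U ^ 2 + R.Gfr 2 * (c / Real.log 4)) < b)
    (hsupp : ∀ p : ℝ × ℝ, h p ≠ 0 → |p.1| < π ∧ |p.2| < π ∧
      |sqDispersion ![p.1, p.2] + frameShift K (WithLp.toLp 2 ![p.1, p.2]) - μ| < ē)
    {H : ℝ → ℝ → E'}
    (hfac : ∀ θ ∈ Ioo (-π) π, ∀ e ∈ Icc (-ē) ē,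
      h (perturbedFermiRadius (fun k : Fin 2 → ℝ => frameShift K (WithLp.toLp 2 k)) (μ + e) θ * Real.cos θ,
          perturbedFermiRadius (fun k : Fin 2 → ℝ => frameShift K (WithLp.toLp 2 k)) (μ + e) θ * Real.sin θ) = H θ e)
    (hodd : ∀ θ e, H θ (-e) = -H θ e) {C : ℝ} (hC : ∀ θ ∈ Ioo (-π) π, ∀ e ∈ Icc (-ē) ē, ‖H θ e‖ ≤ C) :
    ‖∫ p, h p‖ ≤ 2 * π * (2 * (1 / (B.Dtmin - 4 * (2 * R.Gfr 0 * |U| + 2 * R.Gfr 1 * U ^ 2 + R.Gfr 2 * (c / Real.log 4))) ^ 2 +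
        π * Real.sqrt 2 * (2 + 4 * (2 * R.Gfr 0 * |U| + 2 * R.Gfr 1 * U ^ 2 + R.Gfr 2 * (c / Real.log 4))) /
          (B.Dtmin - 4 * (2 * R.Gfr 0 * |U| + 2 * R.Gfr 1 * U ^ 2 + R.Gfr 2 * (c / Real.log 4))) ^ 3) * C * ē ^ 2) := by
  have hAb := klrk_frame_C2_bound hR hc hβmin hβc hK
  have hsm := frameShift_toLp_small hAb le_rfl
  have hA0 : 0 ≤ 2 * R.Gfr 0 * |U| + 2 * R.Gfr 1 * U ^ 2 + R.Gfr 2 * (c / Real.log 4) :=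
    (norm_nonneg _).trans (hAb 0 0 (by norm_num))
  exact klro_integral_oddLevel_norm_le_on B (contDiff_frameShift_toLp K) (fun k _ => hsm.1 k) (fun k _ => hsm.2.1 k) hA
    (by positivity) (fun θ s t _ _ => klrk_frameShift_radial_lipschitz hR hc hβmin hβc hK θ s t)
    hcont hcs hē hlo hhi hsupp hfac hodd hC

end FrameOKOn

/-! ## §7 CONSUMER-READY: the open-square integral of an odd function of the frame band -/

section OpenSq

variable {a b : ℝ} (B : BandBounds a b) {δ : (Fin 2 → ℝ) → ℝ} (hδ1 : ContDiff ℝ 1 δ) {κ₀ κ₁ : ℝ}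
  (hδ : ∀ k : Fin 2 → ℝ, (∀ i, |k i| ≤ π) → |δ k| ≤ κ₀)
  (hκ : ∀ k : Fin 2 → ℝ, (∀ i, |k i| ≤ π) → ‖fderiv ℝ δ k‖ ≤ κ₁) (hκ₁ : κ₁ < B.Dtmin)

include B hδ in
/-- On the boundary of the square the frame band is far above the admissible levels: if `|p₁| ≤ π`, `|p₂| ≤ π` and one of them equals `π` in absolute
value, then `ε₀(p) ≥ 0`, hence `ε₀(p) + δ(p) − μ > ē` whenever `μ + ē + κ₀ < b` (`b < 0`). -/
theorem klro_level_gt_of_mem_boundary {μ ē : ℝ} (hhi : μ + ē + κ₀ < b) {p : ℝ × ℝ} (h1 : |p.1| ≤ π) (h2 : |p.2| ≤ π)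
    (hb : ¬(|p.1| < π ∧ |p.2| < π)) : ē < sqDispersion ![p.1, p.2] + δ ![p.1, p.2] - μ := by
  have hδp : |δ ![p.1, p.2]| ≤ κ₀ := hδ _ (fun i => by fin_cases i <;> simpa)
  have hδp' := (abs_le.mp hδp).1
  have hcos : Real.cos p.1 = -1 ∨ Real.cos p.2 = -1 := by
    by_cases hp1 : |p.1| < π
    · have hp2 : |p.2| = π := le_antisymm h2 (not_lt.mp fun h => hb ⟨hp1, h⟩)
      right
      rcases (abs_eq Real.pi_pos.le).mp hp2 with h | h <;> rw [h] <;> simp [Real.cos_neg, Real.cos_pi]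
    · have hp1' : |p.1| = π := le_antisymm h1 (not_lt.mp hp1)
      left
      rcases (abs_eq Real.pi_pos.le).mp hp1' with h | h <;> rw [h] <;> simp [Real.cos_neg, Real.cos_pi]
  have hε : 0 ≤ sqDispersion ![p.1, p.2] := by
    simp only [sqDispersion, Matrix.cons_val_zero, Matrix.cons_val_one]
    rcases hcos with h | h <;> rw [h] <;> nlinarith [Real.cos_le_one p.1, Real.cos_le_one p.2]
  have hb0 := B.hb
  linarith

include B hδ1 hδ hκ hκ₁ in
/-- **ODDNESS CANCELLATION, open-square form.**  For `F : ℝ → E` continuous, ODD, supported in `(−ē, ē)` with `‖F‖ ≤ C` on `[−ē, ē]`, under the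
`section Frame` hypotheses, the radial `κ₂`, and the margin window `a < μ − ē − κ₀`, `μ + ē + κ₀ < b`:
`‖∫_{(−π,π)²} F(ε₀(p) + δ(p) − μ) dp‖ ≤ 2π · (2 · (1/d² + π√2·(2+κ₂)/d³) · C · ē²)`
(the integrand written as `if |p₁| < π ∧ |p₂| < π then F(…) else 0`, which is continuous because the tube avoids the boundary of the square,
`klro_level_gt_of_mem_boundary`).  This is the shape in which the born row's localised tree × `z_S(iω − e_K)` piece arrives after O1. -/
theorem klro_integral_openSq_oddLevel_norm_le {E' : Type*} [NormedAddCommGroup E'] [NormedSpace ℝ E'] {κ₂ : ℝ} (hκ₂ : 0 ≤ κ₂)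
    (hD2 : ∀ θ s t : ℝ, s ∈ Icc 0 (π / ‖dir θ‖) → t ∈ Icc 0 (π / ‖dir θ‖) →
      |fderiv ℝ δ (s • dir θ) (dir θ) - fderiv ℝ δ (t • dir θ) (dir θ)| ≤ κ₂ * |s - t|)
    {F : ℝ → E'} (hF : Continuous F) (hFodd : ∀ e, F (-e) = -F e) {μ ē : ℝ} (hē : 0 ≤ ē)
    (hlo : a < μ - ē - κ₀) (hhi : μ + ē + κ₀ < b) (hFsupp : ∀ e, F e ≠ 0 → |e| < ē)
    {C : ℝ} (hC : ∀ e ∈ Icc (-ē) ē, ‖F e‖ ≤ C) :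
    ‖∫ p : ℝ × ℝ, (if |p.1| < π ∧ |p.2| < π then F (sqDispersion ![p.1, p.2] + δ ![p.1, p.2] - μ) else 0)‖ ≤
      2 * π * (2 * (1 / (B.Dtmin - κ₁) ^ 2 + π * Real.sqrt 2 * (2 + κ₂) / (B.Dtmin - κ₁) ^ 3) * C * ē ^ 2) := by
  have hδc : Continuous δ := hδ1.continuous
  set g : ℝ × ℝ → E' := fun p => F (sqDispersion ![p.1, p.2] + δ ![p.1, p.2] - μ) with hg
  have hvec : Continuous fun p : ℝ × ℝ => (![p.1, p.2] : Fin 2 → ℝ) := by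
    refine continuous_pi fun i => ?_
    fin_cases i
    · simpa using continuous_fst
    · simpa using continuous_snd
  have hgc : Continuous g :=
    hF.comp (((continuous_sqDispersion.comp hvec).add (hδc.comp hvec)).sub continuous_const)
  -- the square-restricted integrand is continuous: `g` vanishes on the boundary of the square
  have hS : IsOpen {p : ℝ × ℝ | |p.1| < π ∧ |p.2| < π} :=
    (isOpen_lt (continuous_abs.comp continuous_fst) continuous_const).inter
      (isOpen_lt (continuous_abs.comp continuous_snd) continuous_const)
  have hfront : ∀ p ∈ frontier {p : ℝ × ℝ | |p.1| < π ∧ |p.2| < π}, g p = (0 : E') := by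
    intro p hp
    rw [hS.frontier_eq] at hp
    obtain ⟨hcl, hnot⟩ := hp
    have hcl' : p ∈ closure ({p : ℝ × ℝ | |p.1| < π} ∩ {p : ℝ × ℝ | |p.2| < π}) := hcl
    have h12 := closure_inter_subset_inter_closure _ _ hcl'
    have h1 : |p.1| ≤ π := closure_lt_subset_le (continuous_abs.comp continuous_fst) continuous_const h12.1
    have h2 : |p.2| ≤ π := closure_lt_subset_le (continuous_abs.comp continuous_snd) continuous_const h12.2
    have hlev := klro_level_gt_of_mem_boundary B hδ hhi h1 h2 hnot
    by_contra hne
    have := hFsupp _ hne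
    have := (abs_lt.mp this).2
    linarith
  have hc : Continuous fun p : ℝ × ℝ => if |p.1| < π ∧ |p.2| < π then g p else 0 :=
    Continuous.if (fun p hp => by rw [hfront p hp]) hgc continuous_const
  have hcs : HasCompactSupport fun p : ℝ × ℝ => if |p.1| < π ∧ |p.2| < π then g p else 0 := by
    refine HasCompactSupport.intro (isCompact_Icc.prod isCompact_Icc : IsCompact (Icc (-π) π ×ˢ Icc (-π) π)) fun p hp => ?_
    have : ¬(|p.1| < π ∧ |p.2| < π) := by
      intro h
      exact hp ⟨⟨(abs_lt.mp h.1).1.le, (abs_lt.mp h.1).2.le⟩, ⟨(abs_lt.mp h.2).1.le, (abs_lt.mp h.2).2.le⟩⟩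
    simp only [this, if_false]
  have hsupp : ∀ p : ℝ × ℝ, (if |p.1| < π ∧ |p.2| < π then g p else 0) ≠ 0 →
      |p.1| < π ∧ |p.2| < π ∧ |sqDispersion ![p.1, p.2] + δ ![p.1, p.2] - μ| < ē := by
    intro p hp
    by_cases hsq : |p.1| < π ∧ |p.2| < π
    · rw [if_pos hsq] at hp
      exact ⟨hsq.1, hsq.2, hFsupp _ hp⟩
    · rw [if_neg hsq] at hp
      exact absurd rfl hp
  have hfac : ∀ θ ∈ Ioo (-π) π, ∀ e ∈ Icc (-ē) ē,
      (fun p : ℝ × ℝ => if |p.1| < π ∧ |p.2| < π then g p else 0)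
        (perturbedFermiRadius δ (μ + e) θ * Real.cos θ, perturbedFermiRadius δ (μ + e) θ * Real.sin θ) = F e := by
    intro θ hθ e he
    have hν : a ≤ μ + e - κ₀ := by linarith [he.1]
    have hν' : μ + e + κ₀ ≤ b := by linarith [he.2]
    have hsq := klro_rayPt_mem_openSq B hδ hδc hν hν' θ
    simp only [hsq, and_self, if_true, hg]
    congr 1
    rw [klrf_vec_ray]
    have hlev := (isBandFermiRadius_perturbedFermiRadius B hδc hδ hν hν' θ).2
    have hray : sqDispersion (perturbedFermiRadius δ (μ + e) θ • dir θ) = rayDispersion (θ, perturbedFermiRadius δ (μ + e) θ) := rfl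
    rw [hray]
    linarith
  exact klro_integral_oddLevel_norm_le_on B hδ1 hδ hκ hκ₁ hκ₂ hD2 hc hcs hē hlo hhi hsupp (H := fun _ e => F e) hfac
    (fun _ e => hFodd e) (fun _ _ e he => hC e he)

end OpenSq

section OpenSqFrameOK

variable {R : RenConsts} {U c β μ : ℝ} {K : TrigPolyC4v} {a b : ℝ} (B : BandBounds a b)

/-- **Open-square form on an admissible frame** (`klro_integral_openSq_oddLevel_norm_le` with the p4 inputs discharged from `FrameOK` as in §3/§6):
for `F` continuous, odd, supported in `(−ē, ē)`, `‖F‖ ≤ C` on `[−ē, ē]`, and the window `a < μ − ē − 4A`, `μ + ē + 4A < b`: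
`‖∫_{(−π,π)²} F(ε₀(p) + δ_K(p) − μ) dp‖ ≤ 2π · (2 · (1/d² + π√2·(2 + 4A)/d³) · C · ē²)`, `d = B.Dtmin − 4A`. -/
theorem klro_integral_openSq_oddLevel_norm_le_of_frameOK {E' : Type*} [NormedAddCommGroup E'] [NormedSpace ℝ E']
    (hR : ∀ j, 0 ≤ R.Gfr j) (hc : 0 ≤ c) (hβmin : klBetaMin ≤ β) (hβc : β ≤ Real.exp (c / U ^ 2))
    (hK : FrameOK R U (nScales β) μ K)
    (hA : 4 * (2 * R.Gfr 0 * |U| + 2 * R.Gfr 1 * U ^ 2 + R.Gfr 2 * (c / Real.log 4)) < B.Dtmin)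
    {F : ℝ → E'} (hF : Continuous F) (hFodd : ∀ e, F (-e) = -F e) {ē : ℝ} (hē : 0 ≤ ē)
    (hlo : a < μ - ē - 4 * (2 * R.Gfr 0 * |U| + 2 * R.Gfr 1 * U ^ 2 + R.Gfr 2 * (c / Real.log 4)))
    (hhi : μ + ē + 4 * (2 * R.Gfr 0 * |U| + 2 * R.Gfr 1 * U ^ 2 + R.Gfr 2 * (c / Real.log 4)) < b)
    (hFsupp : ∀ e, F e ≠ 0 → |e| < ē) {C : ℝ} (hC : ∀ e ∈ Icc (-ē) ē, ‖F e‖ ≤ C) :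
    ‖∫ p : ℝ × ℝ, (if |p.1| < π ∧ |p.2| < π then
        F (sqDispersion ![p.1, p.2] + frameShift K (WithLp.toLp 2 ![p.1, p.2]) - μ) else 0)‖ ≤
      2 * π * (2 * (1 / (B.Dtmin - 4 * (2 * R.Gfr 0 * |U| + 2 * R.Gfr 1 * U ^ 2 + R.Gfr 2 * (c / Real.log 4))) ^ 2 +
        π * Real.sqrt 2 * (2 + 4 * (2 * R.Gfr 0 * |U| + 2 * R.Gfr 1 * U ^ 2 + R.Gfr 2 * (c / Real.log 4))) /
          (B.Dtmin - 4 * (2 * R.Gfr 0 * |U| + 2 * R.Gfr 1 * U ^ 2 + R.Gfr 2 * (c / Real.log 4))) ^ 3) * C * ē ^ 2) := by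
  have hAb := klrk_frame_C2_bound hR hc hβmin hβc hK
  have hsm := frameShift_toLp_small hAb le_rfl
  have hA0 : 0 ≤ 2 * R.Gfr 0 * |U| + 2 * R.Gfr 1 * U ^ 2 + R.Gfr 2 * (c / Real.log 4) :=
    (norm_nonneg _).trans (hAb 0 0 (by norm_num))
  exact klro_integral_openSq_oddLevel_norm_le B (contDiff_frameShift_toLp K) (fun k _ => hsm.1 k) (fun k _ => hsm.2.1 k) hA
    (by positivity) (fun θ s t _ _ => klrk_frameShift_radial_lipschitz hR hc hβmin hβc hK θ s t)
    hF hFodd hē hlo hhi hFsupp hC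

end OpenSqFrameOK

end Summit.HubbardSuperconductivity.HubbardSuperconductivity.Theorems.KLRegimeSplit

end
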